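import Summits.NavierStokesRegularity.NavierStokesRegularity.Theorems.ClockStretchingLawClockCeilingLerayFloor
import Summits.NavierStokesRegularity.NavierStokesRegularity.Theorems.ClockStretchingLawClockCeilingVorticitySupportBackward
import Summits.NavierStokesRegularity.NavierStokesRegularity.Theorems.SqueezeCycleSingularZoomExtraction
import Summits.NavierStokesRegularity.NavierStokesRegularity.Theorems.SqueezeCycleExtremalElementExistsRescale
import Literature.Analysis.FluidPDE.DirectionDissipation
import Literature.Analysis.FluidPDE.CurlFreeLiouville
import Mathlib.Topology.Algebra.Module.Cardinality
import HarnessLib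

/-!
# Route ClockStretchingLaw, crux `ClockCeiling` (stmt-NavierStokesRegularity-10570) — COMPACTLY
# SUPPORTED VORTICITY on a backward end forces a Type-I ancient field to vanish

Reduction clause of the crux's Type-I ancient class (`IsTypeIAncientMild C u`):

**`stub_compactVorticityLiouville`.** If the vorticity `curl u(t, ·)` is supported in a fixed ball
`{‖x‖ ≤ R}` for all times `t ≤ t₀` of a backward end, then `u ≡ 0`.

Together with the backward propagation of vorticity support (`stub_vorticitySupportBackward`,
Escauriaza–Seregin–Šverák backward uniqueness across half-spaces; sibling file
`…VorticitySupportBackward.lean`) this says: NO slice of a counterexample to the crux has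
compactly supported vorticity (`curlSliceCompactSupportLiouville`), i.e. every slice of a nonzero
Type-I ancient field has vorticity of unbounded support (`curl_support_unbounded_of_ne_zero`).

Proof: zoom OUT along the far-past amplitude floor (`farPastAmplitudeFloor`, sibling file
`…LerayFloor.lean`): `v_k(s, y) = c_k u(c_k² s, x_k + c_k y)`, `c_k = √(−t_k/2) → ∞`, stays in
the class (`isTypeIAncientMild_zoom`) with `‖v_k(−2, 0)‖ > 1/(32√2 C₀)` and vorticity supported,
at times `s ≤ −1`, in balls of radius `R/c_k → 0`; class compactness
(`exists_tendsto_of_typeI_seq_Ioo`) gives a limit `W` in the class whose vorticity vanishes off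
at most one point per slice, hence everywhere; curl- and divergence-free bounded slices are
constant (KNSS Lemma 3.1), and a slice-constant element of the class is zero (the gauge) —
contradicting the floor at `(−2, 0)`.

## References

* G. Koch, N. Nadirashvili, G. Seregin, V. Šverák, Acta Math. 203 (2009) = arXiv:0709.3599,
  Lemma 3.1, Remark 6.1, §6. [KochNadirashviliSereginSverak2009]
* L. Escauriaza, G. Seregin, V. Šverák, Russ. Math. Surveys 58 (2003), Thm. 5.1.
  [EscauriazaSereginSverak2003]
-/

noncomputable section

-- the summit and its single sub-problem share the name (CONVENTIONS §1), as in every Theorems file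
set_option linter.dupNamespace false

open MeasureTheory Set Filter Topology
open Literature.Analysis Literature.Analysis.FluidPDE

namespace Summit.NavierStokesRegularity.NavierStokesRegularity.Theorems

/-! ## Compactly supported vorticity on a backward end forces triviality -/

/-- `√(a/2) = √a / √2`. [folklore] -/
theorem cvl_sqrt_half (a : ℝ) : Real.sqrt (a / 2) = Real.sqrt a / Real.sqrt 2 := by
  rw [Real.sqrt_div' a (by norm_num : (0 : ℝ) ≤ 2)]

/-- **Stub `stub_compactVorticityLiouville` — an element of the Type-I ancient class whose
vorticity is supported in a fixed ball `{‖x‖ ≤ R}` on a whole backward end `t ≤ t₀` vanishes.**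
Proof: if `u ≢ 0`, the far-past amplitude floor (`farPastAmplitudeFloor`) supplies times
`t_k → −∞` and points `x_k` with `√(−t_k)‖u(t_k, x_k)‖ > 1/(32C₀)`. The Navier–Stokes zooms
`v_k(s, y) = c_k u(c_k² s, x_k + c_k y)`, `c_k = √(−t_k/2)`, lie in the class
(`isTypeIAncientMild_zoom`), satisfy `‖v_k(−2, 0)‖ > 1/(32√2 C₀)`, and their vorticity at times
`s ≤ −1` is supported in balls of radius `R/c_k → 0`. A subsequence converges with its gradients
to an element `W` of the class (`exists_tendsto_of_typeI_seq_Ioo`); the set of points captured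
by the shrinking balls for all large indices has at most one element, so `curl W(s, ·)` vanishes
off one point, hence everywhere (continuity, density of the complement of a point); a bounded
curl- and divergence-free slice is constant (KNSS Lemma 3.1,
`eq_of_curl_eq_zero_of_isDivFree_of_bounded`); all slices `s ≤ −1` constant makes the unit time
shift of `W` slice-constant, hence zero (`IsTypeIAncientMild.eq_zero_of_slice_const`) —
contradicting `‖W(−2, 0)‖ ≥ 1/(32√2 C₀)`. With `stub_vorticitySupportBackward` (ESS backward
uniqueness): no slice of a nonzero Type-I ancient field has compactly supported vorticity.
[cite: KochNadirashviliSereginSverak2009, Lemma 3.1, §6 (arXiv:0709.3599)] -/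
theorem stub_compactVorticityLiouville :
    ∀ (C : ℝ) (u : ℝ → EuclideanSpace ℝ (Fin 3) → EuclideanSpace ℝ (Fin 3)), Literature.Analysis.FluidPDE.IsTypeIAncientMild C u → ∀ (t₀ R : ℝ), t₀ < 0 → (∀ t ≤ t₀, ∀ x, R < ‖x‖ → Literature.Analysis.FluidPDE.curl (u t) x = 0) → ∀ t < 0, ∀ x, u t x = 0 := by
  intro C u h t₀ R ht₀ hsupp
  by_contra hne
  push Not at hne
  obtain ⟨t', ht', x', hx'⟩ := hne
  obtain ⟨T, hT, hfloor⟩ := farPastAmplitudeFloor h ⟨t', ht', x', hx'⟩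
  have hC : 0 ≤ C := h.nonneg
  have hC₀ : 0 < oseenSliceConst (EuclideanSpace ℝ (Fin 3)) := oseenSliceConst_pos
  -- ## the marked times `t_k → −∞` and points `x_k` above the floor
  set tk : ℕ → ℝ := fun k => min T (2 * t₀) - ((k : ℝ) + 1) with htk
  have htkT : ∀ k, tk k < T := fun k => by
    have := min_le_left T (2 * t₀); simp only [htk]; linarith
  have htk2 : ∀ k, tk k ≤ 2 * t₀ := fun k => by
    have := min_le_right T (2 * t₀)
    have hk : (0 : ℝ) ≤ k := Nat.cast_nonneg k
    simp only [htk]; linarith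
  have htk0 : ∀ k, tk k < 0 := fun k => (htkT k).trans hT
  have htkle : ∀ k, tk k ≤ -((k : ℝ) + 1) := fun k => by
    have := min_le_left T (2 * t₀); simp only [htk]; linarith
  choose xk hxk using fun k => hfloor (tk k) (htkT k)
  -- ## the zoom factors `c_k = √(−t_k/2)` and the zooms `v_k`
  set ck : ℕ → ℝ := fun k => Real.sqrt (-(tk k) / 2) with hck
  have hck0 : ∀ k, 0 < ck k := fun k => Real.sqrt_pos.2 (by have := htk0 k; linarith)
  have hck2 : ∀ k, ck k ^ 2 = -(tk k) / 2 := fun k => Real.sq_sqrt (by have := htk0 k; linarith)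
  have hckge : ∀ k : ℕ, Real.sqrt (((k : ℝ) + 1) / 2) ≤ ck k := fun k =>
    Real.sqrt_le_sqrt (by have := htkle k; linarith)
  have hck_eq : ∀ k, ck k = Real.sqrt (-(tk k)) / Real.sqrt 2 := fun k => by
    simp only [hck]; exact cvl_sqrt_half _
  set v : ℕ → ℝ → EuclideanSpace ℝ (Fin 3) → EuclideanSpace ℝ (Fin 3) :=
    fun k => ck k • stPull (ck k ^ 2) (ck k) 0 (xk k) u with hv
  have hvk : ∀ k, IsTypeIAncientMild C (v k) := fun k => isTypeIAncientMild_zoom h (hck0 k) (xk k)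
  have hv_apply : ∀ k s y, v k s y = ck k • u (0 + ck k ^ 2 * s) (xk k + ck k • y) := fun k s y => rfl
  -- the marked value `v_k(−2, 0) = c_k u(t_k, x_k)` is above `η = 1/(32 √2 C₀)`
  set η : ℝ := 1 / (32 * oseenSliceConst (EuclideanSpace ℝ (Fin 3)) * Real.sqrt 2) with hη
  have hη0 : 0 < η := by positivity
  have hmark : ∀ k, η < ‖v k (-2) 0‖ := by
    intro k
    have e1 : 0 + ck k ^ 2 * (-2) = tk k := by rw [hck2]; ring
    rw [hv_apply, e1, smul_zero, add_zero, norm_smul, Real.norm_of_nonneg (hck0 k).le, hck_eq]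
    have h2 : 0 < Real.sqrt 2 := Real.sqrt_pos.2 (by norm_num)
    have key := hxk k
    rw [hη, div_lt_iff₀ (by positivity)]
    calc (1 : ℝ) < 32 * oseenSliceConst (EuclideanSpace ℝ (Fin 3)) * (Real.sqrt (-tk k) * ‖u (tk k) (xk k)‖) := key
      _ = Real.sqrt (-tk k) / Real.sqrt 2 * ‖u (tk k) (xk k)‖ *
            (32 * oseenSliceConst (EuclideanSpace ℝ (Fin 3)) * Real.sqrt 2) := by
          field_simp
  -- the vorticity of `v_k` at times `s ≤ −1` vanishes off the ball `B(d_k, R/c_k)`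
  have hcurlv : ∀ k, ∀ s : ℝ, s ≤ -1 → ∀ y : EuclideanSpace ℝ (Fin 3),
      R / ck k < ‖y - (-((ck k)⁻¹ • xk k))‖ → curl (v k s) y = 0 := by
    intro k s hs y hy
    have htime : 0 + ck k ^ 2 * s ≤ t₀ := by
      rw [hck2, zero_add]
      have h1 : -(tk k) / 2 * s ≤ -(tk k) / 2 * (-1) :=
        mul_le_mul_of_nonneg_left hs (by have := htk0 k; linarith)
      have h2 := htk2 k
      linarith
    have hspace : R < ‖xk k + ck k • y‖ := by
      have e : xk k + ck k • y = ck k • (y - (-((ck k)⁻¹ • xk k))) := by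
        rw [sub_neg_eq_add, smul_add, smul_smul, mul_inv_cancel₀ (hck0 k).ne', one_smul, add_comm]
      rw [e, norm_smul, Real.norm_of_nonneg (hck0 k).le]
      rwa [div_lt_iff₀' (hck0 k)] at hy
    have h0 := hsupp _ htime _ hspace
    change curl ((ck k • stPull (ck k ^ 2) (ck k) 0 (xk k) u) s) y = 0
    rw [curl_smul_stPull, h0, smul_zero]
  -- ## compactness of the zooms in the class
  obtain ⟨φ, hφ, W, hW, hval, hgrad, -, -⟩ :=
    exists_tendsto_of_typeI_seq_Ioo C (A := fun k : ℕ => -((k : ℝ) + 1))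
      (w := v)
      (by
        refine tendsto_atBot_mono (fun k => ?_) (tendsto_neg_atTop_atBot.comp
          (tendsto_natCast_atTop_atTop (R := ℝ)))
        simp)
      (fun k => (hvk k).continuousOn_uncurry.mono (prod_mono Ioo_subset_Iio_self le_rfl))
      (fun k t ht => (hvk k).isWeaklyDivFree ht.2)
      (fun k s t _ hst ht x => (hvk k).mild_eq_heatExtension hst ht x)
      (fun k t ht x => (hvk k).norm_le ht.2 x)
  -- the limit is above the floor at `(−2, 0)`
  have hWmark : η ≤ ‖W (-2) 0‖ := by
    have hl : Tendsto (fun j => ‖v (φ j) (-2) 0‖) atTop (𝓝 ‖W (-2) 0‖) :=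
      (continuous_norm.tendsto _).comp (hval (-2) (by norm_num) 0)
    exact ge_of_tendsto hl (Eventually.of_forall fun j => (hmark (φ j)).le)
  -- the radii `R / c_{φ j} → 0`
  have hcφ : Tendsto (fun j => ck (φ j)) atTop atTop := by
    have h1 : Tendsto (fun j : ℕ => Real.sqrt (((j : ℝ) + 1) / 2)) atTop atTop := by
      have h0 : Tendsto (fun j : ℕ => ((j : ℝ) + 1) / 2) atTop atTop :=
        (tendsto_atTop_add_const_right _ 1 (tendsto_natCast_atTop_atTop (R := ℝ))).atTop_div_const
          (by norm_num)
      exact Real.tendsto_sqrt_atTop.comp h0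
    refine tendsto_atTop_mono (fun j => ?_) h1
    calc Real.sqrt (((j : ℝ) + 1) / 2) ≤ Real.sqrt (((φ j : ℝ) + 1) / 2) :=
          Real.sqrt_le_sqrt (by
            have : (j : ℝ) ≤ (φ j : ℝ) := by exact_mod_cast hφ.id_le j
            linarith)
      _ ≤ ck (φ j) := hckge (φ j)
  have hρ : Tendsto (fun j => R / ck (φ j)) atTop (𝓝 0) := Tendsto.div_atTop tendsto_const_nhds hcφ
  -- ## the limit vorticity vanishes at every time `s ≤ −1`
  have hcurlW : ∀ s : ℝ, s ≤ -1 → ∀ y, curl (W s) y = 0 := by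
    intro s hs
    have hs0 : s < 0 := by linarith
    set d : ℕ → EuclideanSpace ℝ (Fin 3) := fun j => -((ck (φ j))⁻¹ • xk (φ j)) with hd
    set ρ : ℕ → ℝ := fun j => R / ck (φ j) with hρdef
    -- points escaping the balls frequently are zeros of `curl W(s)`
    have hgood : ∀ y, (∃ᶠ j in atTop, ρ j < ‖y - d j‖) → curl (W s) y = 0 := by
      intro y hy
      have hlim : Tendsto (fun j => curl (v (φ j) s) y) atTop (𝓝 (curl (W s) y)) := by
        simp only [curl_eq_curlCLM]
        exact (curlCLM.continuous.tendsto _).comp (hgrad s hs0 y)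
      have hfreq : ∃ᶠ j in atTop, curl (v (φ j) s) y ∈ ({0} : Set (EuclideanSpace ℝ (Fin 3))) :=
        hy.mono fun j hj => by
          rw [mem_singleton_iff]
          exact hcurlv (φ j) s hs y hj
      have := mem_closure_of_frequently_of_tendsto hfreq hlim
      rwa [closure_singleton, mem_singleton_iff] at this
    -- two points captured by the balls for all large `j` coincide
    have hbad : ∀ y₁ y₂ : EuclideanSpace ℝ (Fin 3), (∀ᶠ j in atTop, ‖y₁ - d j‖ ≤ ρ j) →
        (∀ᶠ j in atTop, ‖y₂ - d j‖ ≤ ρ j) → y₁ = y₂ := by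
      intro y₁ y₂ h1 h2
      have hle : ∀ᶠ j in atTop, ‖y₁ - y₂‖ ≤ 2 * ρ j := by
        filter_upwards [h1, h2] with j hj1 hj2
        calc ‖y₁ - y₂‖ = ‖(y₁ - d j) - (y₂ - d j)‖ := by congr 1; abel
          _ ≤ ‖y₁ - d j‖ + ‖y₂ - d j‖ := norm_sub_le _ _
          _ ≤ 2 * ρ j := by linarith
      have h2ρ : Tendsto (fun j => 2 * ρ j) atTop (𝓝 0) := by
        simpa using hρ.const_mul 2
      have h0 : ‖y₁ - y₂‖ ≤ 0 := le_of_tendsto_of_tendsto tendsto_const_nhds h2ρ hle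
      exact sub_eq_zero.1 (norm_le_zero_iff.1 h0)
    have hcont : Continuous (curl (W s)) := by
      rw [curl_eq_curlCLM_comp]
      exact curlCLM.continuous.comp ((hW.contDiff_slice hs0).continuous_fderiv (by simp))
    by_cases hex : ∃ y₀ : EuclideanSpace ℝ (Fin 3), ∀ᶠ j in atTop, ‖y₀ - d j‖ ≤ ρ j
    · obtain ⟨y₀, hy₀⟩ := hex
      have hoff : ∀ y, y ≠ y₀ → curl (W s) y = 0 := by
        intro y hy
        refine hgood y ?_
        by_contra hcon
        rw [Filter.not_frequently] at hcon
        exact hy (hbad y y₀ (hcon.mono fun j hj => not_lt.1 hj) hy₀)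
      have hdense : Dense ({y₀}ᶜ : Set (EuclideanSpace ℝ (Fin 3))) :=
        (Set.countable_singleton y₀).dense_compl ℝ
      have hext := Continuous.ext_on hdense hcont continuous_const fun y hy => hoff y hy
      exact fun y => congrFun hext y
    · intro y
      have h1 : ¬ ∀ᶠ j in atTop, ‖y - d j‖ ≤ ρ j := fun hh => hex ⟨y, hh⟩
      exact hgood y ((Filter.not_eventually.1 h1).mono fun j hj => not_le.1 hj)
  -- ## every slice `s ≤ −1` of `W` is constant in space
  have hconst : ∀ s : ℝ, s ≤ -1 → ∀ y, W s y = W s 0 := by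
    intro s hs y
    have hs0 : s < 0 := by linarith
    exact eq_of_curl_eq_zero_of_isDivFree_of_bounded
      ((hW.contDiff_slice hs0).of_le (by norm_cast)) (hcurlW s hs) (hW.isDivFree hs0)
      (fun x => hW.norm_le hs0 x) y 0
  -- ## the unit time shift of `W` is slice-constant, hence zero: contradiction at `(−2, 0)`
  have hW₁ : IsTypeIAncientMild C (fun s => W (s - 1)) := hW.comp_sub_right zero_le_one
  have hzero : W (-2) 0 = 0 := by
    have := hW₁.eq_zero_of_slice_const (b := fun s => W (s - 1) 0)
      (fun s hs y => hconst (s - 1) (by linarith) y) (t := -1) (by norm_num) 0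
    norm_num at this
    exact this
  have : η ≤ 0 := by simpa [hzero] using hWmark
  exact (not_le.2 hη0) this

/-- **No slice of a nonzero Type-I ancient field has compactly supported vorticity.** If
`curl u(t₀, ·)` vanishes outside a ball `{‖x‖ ≤ R}` for one `t₀ < 0`, then `u ≡ 0`: the support
propagates backward (`stub_vorticitySupportBackward`, Escauriaza–Seregin–Šverák backward uniqueness
across half-spaces) and `stub_compactVorticityLiouville` applies.
[cite: EscauriazaSereginSverak2003, Thm. 5.1] -/
theorem curlSliceCompactSupportLiouville {C : ℝ}
    {u : ℝ → EuclideanSpace ℝ (Fin 3) → EuclideanSpace ℝ (Fin 3)} (h : IsTypeIAncientMild C u)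
    {t₀ R : ℝ} (ht₀ : t₀ < 0) (hR : ∀ x, R < ‖x‖ → curl (u t₀) x = 0) :
    ∀ t < 0, ∀ x, u t x = 0 :=
  stub_compactVorticityLiouville C u h t₀ R ht₀ (stub_vorticitySupportBackward C u h t₀ R ht₀ hR)

/-- **Portrait clause: every slice of a counterexample's vorticity has UNBOUNDED support** — for a
nonzero element of the Type-I ancient class, at every time `t₀ < 0` and for every radius `R` there
is a point `‖x‖ > R` with `curl u(t₀, x) ≠ 0`. [cite: EscauriazaSereginSverak2003, Thm. 5.1] -/
theorem curl_support_unbounded_of_ne_zero {C : ℝ}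
    {u : ℝ → EuclideanSpace ℝ (Fin 3) → EuclideanSpace ℝ (Fin 3)} (h : IsTypeIAncientMild C u)
    (hne : ∃ t < 0, ∃ x, u t x ≠ 0) {t₀ : ℝ} (ht₀ : t₀ < 0) (R : ℝ) :
    ∃ x, R < ‖x‖ ∧ curl (u t₀) x ≠ 0 := by
  by_contra hcon
  push Not at hcon
  obtain ⟨t, ht, x, hx⟩ := hne
  exact hx (curlSliceCompactSupportLiouville h ht₀ (fun y hy => hcon y hy) t ht x)

end Summit.NavierStokesRegularity.NavierStokesRegularity.Theorems

end
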